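import Literature.Computability.AlgebraicComplexity.QuantumFunctionalsUpperKroneckerRuleProofs
import Literature.Computability.AlgebraicComplexity.QuantumFunctionalsUpperProofs
import Literature.Computability.AlgebraicComplexity.IsotypicCommutantSpan
import HarnessLib

/-!
# The isotypic components of `(ℂ^{N₁} ⊗ ℂ^{N₂} ⊗ ℂ^{N₃})^{⊗n}` are generated by highest-weight vectors

Topic `Literature/Computability/AlgebraicComplexity`; representation-theoretic input for the
direction `E^θ(t) ≤ E_θ(t)` of Christandl–Vrana–Zuiddam, *Universal points in the asymptotic spectrum
of tensors*, J. Amer. Math. Soc. 36 (2023) = arXiv:1709.07851v3, **Thm. 3.30** (the named fact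
`ChristandlVranaZuiddam2023_upper_eq_lower` of `QuantumFunctionalsUpper.lean`), i.e. the inclusion of
the entanglement polytope described by non-vanishing isotypic projections (Def. 3.3) in the closure of
the marginal spectra over the orbit (Thm. 3.29: Ness–Mumford, Brion, Walter–Doran–Gross–Christandl).
The analytic half of that inclusion is the sibling file `QuantumFunctionalsSemiInvariant.lean` (a
non-vanishing highest-weight covariant of weight `(λ, μ, ν)` forces `E_θ ≥ ∑ θ_j H(weight/n)`); the
link from "the isotypic projection `(P_{λ^{(1)}} ⊗ P_{λ^{(2)}} ⊗ P_{λ^{(3)}}) u ≠ 0`" to highest-weight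
vectors is Schur–Weyl duality in *span form*. For one tensor factor this is the tree's
`Literature.RepresentationTheory.GeneralLinear.range_isotypicProj_wordPermRep`
(`WordModelIsotypicSpan.lean`: `P_λ (ℂ^N)^{⊗n} = span {g · ξ | g ∈ GL_N, ξ ∈ HW_λ}` in the word model
`wordRep ℂ N n`, `HW_λ = highestWeightSpace … (Weight.ofPartition N λ)` for the upper triangular Borel
subgroup). This file PROVES the three-factor version in the coordinates of `QuantumFunctionalsUpper.lean`
(functions of three words, alphabets `Fin N_j`, isotypic character sums
`isotypicSumⱼ λ = ∑_π χ_λ(π) (π ·ⱼ ·)`):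

* `isotypicSum₁₂₃_mem_span_glOrbitHighestWeight₃` — **main theorem**: for every triple
  `λ = (λ^{(1)}, λ^{(2)}, λ^{(3)})` and every `u`, `P₁ P₂ P₃ u` (with `Pⱼ = isotypicSumⱼ λ^{(j)}`) is a
  `ℂ`-linear combination of tensors `(g₁^{⊗n} ⊗ g₂^{⊗n} ⊗ g₃^{⊗n}) (φ₁ ⊗ φ₂ ⊗ φ₃)` with
  `g_j ∈ GL_{N_j}(ℂ)` and `φ_j ∈ HW_{λ^{(j)}}` (the set `glOrbitHighestWeight₃` of such translates).
* One factor (`sum_spechtCharacter_smul_wordPerm_mem_span`): `∑_π χ_λ(π) π·v ∈ span (glOrbitHighestWeight N n λ)`,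
  where `glOrbitHighestWeight` IS the generating set of `range_isotypicProj_wordPermRep`; a direct
  rewrite of that theorem once the character sum is identified with Serre's projector,
  `∑_π χ_λ(π) π·v = P_λ((n!/χ_λ(1)) v)` (`sum_spechtCharacter_smul_wordPerm_eq_isotypicProj`).
* Three factors: outer products `triad φ₁ φ₂ φ₃` (tree: `triad`, `actTensor_triad`), their linearity
  (`triadₗ₁/₂/₃`, any commutative semiring), the decomposition `u = ∑ u(a,b,c) δ_a ⊗ δ_b ⊗ δ_c`
  (`eq_sum_smul_triad_single`), the leg actions on outer products (`isotypicSumⱼ_triad`),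
  `(g₁^{⊗n} ⊗ g₂^{⊗n} ⊗ g₃^{⊗n})(φ₁ ⊗ φ₂ ⊗ φ₃) = (g₁φ₁) ⊗ (g₂φ₂) ⊗ (g₃φ₃)` (`actTensor_powMat_triad`), and
  the trilinear span bookkeeping (`triad_mem_span_glOrbitHighestWeight₃`).

## References

* M. Christandl, P. Vrana, J. Zuiddam, J. Amer. Math. Soc. 36 (2023) 31–79 = arXiv:1709.07851v3,
  §3.1 (Schur–Weyl duality (sw), the projectors `P_λ^V`, Def. 3.3), §3.4 (Thm. 3.29, Thm. 3.30).
  [ChristandlVranaZuiddam2023]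
* W. Fulton, J. Harris, *Representation Theory. A First Course*, GTM 129 (1991), Thm. 6.3 (2), (4),
  §15.5. [FultonHarrisGTM129]
* J.-P. Serre, *Linear Representations of Finite Groups*, GTM 42, §2.6 Thm. 8.
  [SerreLinearRepresentations1977]

## Mathlib and tree

Mathlib: `Submodule.apply_mem_span_image_of_mem_span`, `Submodule.span_le`, `LinearMap.mem_range_self`,
`Fintype.sum_equiv`. Tree: `range_isotypicProj_wordPermRep`
(`Literature.RepresentationTheory.GeneralLinear`), `isotypicProj`, `isotypicProj_apply`,
`spechtCharacter_inv` (`Literature.RepresentationTheory.FiniteGroups`), `wordRep`, `wordPerm`,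
`wordPermRep`, `highestWeightSpace`, `Weight.ofPartition` (`Literature.NumberTheory.DiophantineGeometry`),
`permLegsRepⱼ`, `spechtCharacter_one_ne_zero`, `wordRep_eq_powMat_mulVec`, `powMat`, `triad`,
`actTensor_triad`, `isotypicSumⱼ` (`Literature.Computability.AlgebraicComplexity`). Definitions
introduced: `triadₗ₁/₂/₃` (bundled linearity of `triad`), `glOrbitHighestWeight` (the generating set of
`range_isotypicProj_wordPermRep`, named), `glOrbitHighestWeight₃` (its three-factor analogue). No named
facts.
-/

noncomputable section

open scoped BigOperators Matrix

namespace Literature.Computability.AlgebraicComplexity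

open Literature.NumberTheory.DiophantineGeometry
open Literature.RepresentationTheory.FiniteGroups (isotypicProj isotypicProj_apply)
open Literature.RepresentationTheory.GeneralLinear (range_isotypicProj_wordPermRep)

/-! ## §1 Outer products (`triad`) of functions: linearity bookkeeping -/

section Outer

variable {K : Type*} [CommSemiring K] {α β γ : Type*}

/-- `triad` is additive in the first slot. [folklore] -/
theorem triad_add₁ (φ₁ φ₁' : α → K) (φ₂ : β → K) (φ₃ : γ → K) :
    triad (φ₁ + φ₁') φ₂ φ₃ = triad φ₁ φ₂ φ₃ + triad φ₁' φ₂ φ₃ := by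
  funext a b c; simp [triad, add_mul]

/-- `triad` is additive in the second slot. [folklore] -/
theorem triad_add₂ (φ₁ : α → K) (φ₂ φ₂' : β → K) (φ₃ : γ → K) :
    triad φ₁ (φ₂ + φ₂') φ₃ = triad φ₁ φ₂ φ₃ + triad φ₁ φ₂' φ₃ := by
  funext a b c; simp [triad, mul_add, add_mul]

/-- `triad` is additive in the third slot. [folklore] -/
theorem triad_add₃ (φ₁ : α → K) (φ₂ : β → K) (φ₃ φ₃' : γ → K) :
    triad φ₁ φ₂ (φ₃ + φ₃') = triad φ₁ φ₂ φ₃ + triad φ₁ φ₂ φ₃' := by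
  funext a b c; simp [triad, mul_add]

/-- `triad` is homogeneous in the first slot. [folklore] -/
theorem triad_smul₁ (r : K) (φ₁ : α → K) (φ₂ : β → K) (φ₃ : γ → K) :
    triad (r • φ₁) φ₂ φ₃ = r • triad φ₁ φ₂ φ₃ := by
  funext a b c; simp [triad]; ring

/-- `triad` is homogeneous in the second slot. [folklore] -/
theorem triad_smul₂ (r : K) (φ₁ : α → K) (φ₂ : β → K) (φ₃ : γ → K) :
    triad φ₁ (r • φ₂) φ₃ = r • triad φ₁ φ₂ φ₃ := by
  funext a b c; simp [triad]; ring

/-- `triad` is homogeneous in the third slot. [folklore] -/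
theorem triad_smul₃ (r : K) (φ₁ : α → K) (φ₂ : β → K) (φ₃ : γ → K) :
    triad φ₁ φ₂ (r • φ₃) = r • triad φ₁ φ₂ φ₃ := by
  funext a b c; simp [triad]; ring

/-- `triad` vanishes when a slot does. [folklore] -/
@[simp] theorem triad_zero₁ (φ₂ : β → K) (φ₃ : γ → K) : triad (0 : α → K) φ₂ φ₃ = 0 := by
  funext a b c; simp [triad]

/-- `triad` vanishes when a slot does. [folklore] -/
@[simp] theorem triad_zero₂ (φ₁ : α → K) (φ₃ : γ → K) : triad φ₁ (0 : β → K) φ₃ = 0 := by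
  funext a b c; simp [triad]

/-- `triad` vanishes when a slot does. [folklore] -/
@[simp] theorem triad_zero₃ (φ₁ : α → K) (φ₂ : β → K) : triad φ₁ φ₂ (0 : γ → K) = 0 := by
  funext a b c; simp [triad]

/-- `triad` as a linear map in the first slot. [folklore] -/
def triadₗ₁ (φ₂ : β → K) (φ₃ : γ → K) : (α → K) →ₗ[K] (α → β → γ → K) where
  toFun φ₁ := triad φ₁ φ₂ φ₃
  map_add' := fun φ₁ φ₁' => triad_add₁ φ₁ φ₁' φ₂ φ₃
  map_smul' := fun r φ₁ => triad_smul₁ r φ₁ φ₂ φ₃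

/-- `triad` as a linear map in the second slot. [folklore] -/
def triadₗ₂ (φ₁ : α → K) (φ₃ : γ → K) : (β → K) →ₗ[K] (α → β → γ → K) where
  toFun φ₂ := triad φ₁ φ₂ φ₃
  map_add' := fun φ₂ φ₂' => triad_add₂ φ₁ φ₂ φ₂' φ₃
  map_smul' := fun r φ₂ => triad_smul₂ r φ₁ φ₂ φ₃

/-- `triad` as a linear map in the third slot. [folklore] -/
def triadₗ₃ (φ₁ : α → K) (φ₂ : β → K) : (γ → K) →ₗ[K] (α → β → γ → K) where
  toFun φ₃ := triad φ₁ φ₂ φ₃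
  map_add' := fun φ₃ φ₃' => triad_add₃ φ₁ φ₂ φ₃ φ₃'
  map_smul' := fun r φ₃ => triad_smul₃ r φ₁ φ₂ φ₃

/-- Unfolding of `triadₗ₁`. [folklore] -/
@[simp] theorem triadₗ₁_apply (φ₁ : α → K) (φ₂ : β → K) (φ₃ : γ → K) :
    triadₗ₁ φ₂ φ₃ φ₁ = triad φ₁ φ₂ φ₃ := rfl

/-- Unfolding of `triadₗ₂`. [folklore] -/
@[simp] theorem triadₗ₂_apply (φ₁ : α → K) (φ₂ : β → K) (φ₃ : γ → K) :
    triadₗ₂ φ₁ φ₃ φ₂ = triad φ₁ φ₂ φ₃ := rfl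

/-- Unfolding of `triadₗ₃`. [folklore] -/
@[simp] theorem triadₗ₃_apply (φ₁ : α → K) (φ₂ : β → K) (φ₃ : γ → K) :
    triadₗ₃ φ₁ φ₂ φ₃ = triad φ₁ φ₂ φ₃ := rfl

/-- `triad` commutes with finite sums in the first slot. [folklore] -/
theorem triad_sum₁ {ι' : Type*} (s : Finset ι') (f : ι' → α → K) (φ₂ : β → K) (φ₃ : γ → K) :
    triad (∑ i ∈ s, f i) φ₂ φ₃ = ∑ i ∈ s, triad (f i) φ₂ φ₃ := by
  rw [← triadₗ₁_apply, map_sum]; rfl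

/-- `triad` commutes with finite sums in the second slot. [folklore] -/
theorem triad_sum₂ {ι' : Type*} (s : Finset ι') (φ₁ : α → K) (f : ι' → β → K) (φ₃ : γ → K) :
    triad φ₁ (∑ i ∈ s, f i) φ₃ = ∑ i ∈ s, triad φ₁ (f i) φ₃ := by
  rw [← triadₗ₂_apply, map_sum]; rfl

/-- `triad` commutes with finite sums in the third slot. [folklore] -/
theorem triad_sum₃ {ι' : Type*} (s : Finset ι') (φ₁ : α → K) (φ₂ : β → K) (f : ι' → γ → K) :
    triad φ₁ φ₂ (∑ i ∈ s, f i) = ∑ i ∈ s, triad φ₁ φ₂ (f i) := by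
  rw [← triadₗ₃_apply, map_sum]; rfl

/-- **Every three-slot function is a combination of outer products of indicators**:
`u = ∑_{a,b,c} u(a,b,c) • δ_a ⊗ δ_b ⊗ δ_c`. [folklore] -/
theorem eq_sum_smul_triad_single [Fintype α] [Fintype β] [Fintype γ] [DecidableEq α] [DecidableEq β]
    [DecidableEq γ] (u : α → β → γ → K) :
    u = ∑ a, ∑ b, ∑ c, u a b c • triad (Pi.single a 1) (Pi.single b 1) (Pi.single c 1) := by
  funext a b c
  rw [Finset.sum_apply, Finset.sum_apply, Finset.sum_apply]
  simp_rw [Finset.sum_apply, Pi.smul_apply, triad_apply, smul_eq_mul]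
  rw [Finset.sum_eq_single a, Finset.sum_eq_single b, Finset.sum_eq_single c]
  · simp
  · intro c' _ hc'; simp [Pi.single_eq_of_ne hc'.symm]
  · intro h; exact absurd (Finset.mem_univ c) h
  · intro b' _ hb'; simp [Pi.single_eq_of_ne hb'.symm]
  · intro h; exact absurd (Finset.mem_univ b) h
  · intro a' _ ha'; simp [Pi.single_eq_of_ne ha'.symm]
  · intro h; exact absurd (Finset.mem_univ a) h

end Outer

/-! ## §2 The leg actions on outer products of functions on words -/

section Legs

variable {N₁ N₂ N₃ n : ℕ}

/-- The first-leg action of `π` on an outer product permutes the positions of the first word.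
[folklore] -/
theorem permLegs₁_triad (π : Equiv.Perm (Fin n)) (φ₁ : Word N₁ n → ℂ) (φ₂ : Word N₂ n → ℂ)
    (φ₃ : Word N₃ n → ℂ) : permLegs₁ π (triad φ₁ φ₂ φ₃) = triad (wordPerm ℂ π φ₁) φ₂ φ₃ := rfl

/-- The second-leg action on an outer product. [folklore] -/
theorem permLegs₂_triad (π : Equiv.Perm (Fin n)) (φ₁ : Word N₁ n → ℂ) (φ₂ : Word N₂ n → ℂ)
    (φ₃ : Word N₃ n → ℂ) : permLegs₂ π (triad φ₁ φ₂ φ₃) = triad φ₁ (wordPerm ℂ π φ₂) φ₃ := rfl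

/-- The third-leg action on an outer product. [folklore] -/
theorem permLegs₃_triad (π : Equiv.Perm (Fin n)) (φ₁ : Word N₁ n → ℂ) (φ₂ : Word N₂ n → ℂ)
    (φ₃ : Word N₃ n → ℂ) : permLegs₃ π (triad φ₁ φ₂ φ₃) = triad φ₁ φ₂ (wordPerm ℂ π φ₃) := rfl

/-- The first-leg isotypic character sum of an outer product is the character sum of the first
factor: `P₁(φ₁ ⊗ φ₂ ⊗ φ₃) = (∑_π χ_λ(π) π·φ₁) ⊗ φ₂ ⊗ φ₃`. [cite: ChristandlVranaZuiddam2023, §3.1] -/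
theorem isotypicSum₁_triad (lam : Nat.Partition n) (φ₁ : Word N₁ n → ℂ) (φ₂ : Word N₂ n → ℂ)
    (φ₃ : Word N₃ n → ℂ) :
    isotypicSum₁ lam (triad φ₁ φ₂ φ₃) =
      triad (∑ π : Equiv.Perm (Fin n), spechtCharacter ℂ lam π • wordPerm ℂ π φ₁) φ₂ φ₃ := by
  rw [isotypicSum₁_def, triad_sum₁]
  refine Finset.sum_congr rfl fun π _ => ?_
  rw [triad_smul₁, permLegs₁_triad]

/-- The same on the second leg. [cite: ChristandlVranaZuiddam2023, §3.1] -/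
theorem isotypicSum₂_triad (lam : Nat.Partition n) (φ₁ : Word N₁ n → ℂ) (φ₂ : Word N₂ n → ℂ)
    (φ₃ : Word N₃ n → ℂ) :
    isotypicSum₂ lam (triad φ₁ φ₂ φ₃) =
      triad φ₁ (∑ π : Equiv.Perm (Fin n), spechtCharacter ℂ lam π • wordPerm ℂ π φ₂) φ₃ := by
  rw [isotypicSum₂, triad_sum₂]
  refine Finset.sum_congr rfl fun π _ => ?_
  rw [triad_smul₂, permLegs₂_triad]

/-- The same on the third leg. [cite: ChristandlVranaZuiddam2023, §3.1] -/
theorem isotypicSum₃_triad (lam : Nat.Partition n) (φ₁ : Word N₁ n → ℂ) (φ₂ : Word N₂ n → ℂ)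
    (φ₃ : Word N₃ n → ℂ) :
    isotypicSum₃ lam (triad φ₁ φ₂ φ₃) =
      triad φ₁ φ₂ (∑ π : Equiv.Perm (Fin n), spechtCharacter ℂ lam π • wordPerm ℂ π φ₃) := by
  rw [isotypicSum₃, triad_sum₃]
  refine Finset.sum_congr rfl fun π _ => ?_
  rw [triad_smul₃, permLegs₃_triad]

/-- The three-factor action of `(g₁, g₂, g₃) ∈ GL × GL × GL` on an outer product of functions on
words is the outer product of the word-model actions. [folklore] -/
theorem actTensor_powMat_triad (g₁ : GL (Fin N₁) ℂ) (g₂ : GL (Fin N₂) ℂ) (g₃ : GL (Fin N₃) ℂ)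
    (φ₁ : Word N₁ n → ℂ) (φ₂ : Word N₂ n → ℂ) (φ₃ : Word N₃ n → ℂ) :
    actTensor (powMat (g₁ : Matrix (Fin N₁) (Fin N₁) ℂ) n) (powMat (g₂ : Matrix (Fin N₂) (Fin N₂) ℂ) n)
        (powMat (g₃ : Matrix (Fin N₃) (Fin N₃) ℂ) n) (triad φ₁ φ₂ φ₃) =
      triad (wordRep ℂ N₁ n g₁ φ₁) (wordRep ℂ N₂ n g₂ φ₂) (wordRep ℂ N₃ n g₃ φ₃) := by
  rw [actTensor_triad, wordRep_eq_powMat_mulVec, wordRep_eq_powMat_mulVec, wordRep_eq_powMat_mulVec]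

end Legs

/-! ## §3 The isotypic components are generated by highest-weight vectors -/

section Generated

variable {N₁ N₂ N₃ n : ℕ}

/-- The `GL_N`-translates `g · ξ` of the highest-weight vectors `ξ` of weight `λ` in the word model of
`(ℂ^N)^{⊗n}` — the generating set of the `λ`-isotypic component in
`Literature.RepresentationTheory.GeneralLinear.range_isotypicProj_wordPermRep`. [folklore] -/
def glOrbitHighestWeight (N n : ℕ) (lam : Nat.Partition n) : Set (Word N n → ℂ) :=
  Set.range fun p : GL (Fin N) ℂ × highestWeightSpace (wordRep ℂ N n) (Weight.ofPartition N lam) =>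
    wordRep ℂ N n p.1 (p.2 : Word N n → ℂ)

/-- The unnormalised character sum is Serre's projector up to the factor `n!/χ_λ(1)`:
`∑_π χ_λ(π) π·v = P_λ ((n!/χ_λ(1)) • v)` (re-index `t ↦ t⁻¹`, `χ_λ(t⁻¹) = χ_λ(t)`).
[cite: SerreLinearRepresentations1977, §2.6 Thm. 8] -/
theorem sum_spechtCharacter_smul_wordPerm_eq_isotypicProj {N : ℕ} (lam : Nat.Partition n)
    (v : Word N n → ℂ) :
    ∑ π : Equiv.Perm (Fin n), spechtCharacter ℂ lam π • wordPerm ℂ π v =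
      isotypicProj (wordPermRep ℂ N n) (spechtCharacter ℂ lam)
        (((Fintype.card (Equiv.Perm (Fin n)) : ℂ) / spechtCharacter ℂ lam 1) • v) := by
  have h1 : spechtCharacter ℂ lam 1 ≠ 0 := spechtCharacter_one_ne_zero lam
  have hc : ((Fintype.card (Equiv.Perm (Fin n)) : ℂ)) ≠ 0 := Nat.cast_ne_zero.2 Fintype.card_ne_zero
  rw [map_smul, isotypicProj_apply, Finset.smul_sum]
  refine Fintype.sum_equiv (Equiv.inv _) _ _ fun t => ?_
  rw [Equiv.inv_apply, wordPermRep_apply, inv_inv, smul_smul,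
    ← Literature.RepresentationTheory.FiniteGroups.spechtCharacter_inv lam t]
  congr 1
  field_simp

/-- **One factor** (Schur–Weyl duality, span form, from the tree's
`range_isotypicProj_wordPermRep`: `P_λ (ℂ^N)^{⊗n} = span {g · ξ | g ∈ GL_N, ξ ∈ HW_λ}`): the
`λ`-isotypic character sum `∑_π χ_λ(π) π·v` of every `v : Word N n → ℂ` is a linear combination of
`GL_N`-translates of highest-weight vectors of weight `λ` (for every `λ ⊢ n`; both sides vanish when
`ℓ(λ) > N`). [cite: FultonHarrisGTM129, Thm. 6.3] -/
theorem sum_spechtCharacter_smul_wordPerm_mem_span {N : ℕ} (lam : Nat.Partition n) (v : Word N n → ℂ) :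
    ∑ π : Equiv.Perm (Fin n), spechtCharacter ℂ lam π • wordPerm ℂ π v ∈
      Submodule.span ℂ (glOrbitHighestWeight N n lam) := by
  rw [sum_spechtCharacter_smul_wordPerm_eq_isotypicProj, glOrbitHighestWeight,
    ← range_isotypicProj_wordPermRep]
  exact LinearMap.mem_range_self _ _

/-- The `GL × GL × GL`-translates of the outer products `φ₁ ⊗ φ₂ ⊗ φ₃` of highest-weight vectors of
weights `λ^{(1)}, λ^{(2)}, λ^{(3)}` in the word model of `(ℂ^{N₁} ⊗ ℂ^{N₂} ⊗ ℂ^{N₃})^{⊗n}` (the joint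
highest-weight vectors of the `(λ^{(1)}, λ^{(2)}, λ^{(3)})`-isotypic component and their orbit).
[folklore] -/
def glOrbitHighestWeight₃ (N₁ N₂ N₃ n : ℕ) (lam : Fin 3 → Nat.Partition n) :
    Set (Word N₁ n → Word N₂ n → Word N₃ n → ℂ) :=
  {w | ∃ (g₁ : GL (Fin N₁) ℂ) (g₂ : GL (Fin N₂) ℂ) (g₃ : GL (Fin N₃) ℂ) (φ₁ : Word N₁ n → ℂ)
      (φ₂ : Word N₂ n → ℂ) (φ₃ : Word N₃ n → ℂ),
    φ₁ ∈ highestWeightSpace (wordRep ℂ N₁ n) (Weight.ofPartition N₁ (lam 0)) ∧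
    φ₂ ∈ highestWeightSpace (wordRep ℂ N₂ n) (Weight.ofPartition N₂ (lam 1)) ∧
    φ₃ ∈ highestWeightSpace (wordRep ℂ N₃ n) (Weight.ofPartition N₃ (lam 2)) ∧
    w = actTensor (powMat (g₁ : Matrix (Fin N₁) (Fin N₁) ℂ) n) (powMat (g₂ : Matrix (Fin N₂) (Fin N₂) ℂ) n)
        (powMat (g₃ : Matrix (Fin N₃) (Fin N₃) ℂ) n) (triad φ₁ φ₂ φ₃)}

/-- Outer products of orbit vectors are orbit vectors of outer products. [folklore] -/
theorem triad_mem_glOrbitHighestWeight₃ {lam : Fin 3 → Nat.Partition n} {s₁ : Word N₁ n → ℂ}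
    {s₂ : Word N₂ n → ℂ} {s₃ : Word N₃ n → ℂ} (h₁ : s₁ ∈ glOrbitHighestWeight N₁ n (lam 0))
    (h₂ : s₂ ∈ glOrbitHighestWeight N₂ n (lam 1)) (h₃ : s₃ ∈ glOrbitHighestWeight N₃ n (lam 2)) :
    triad s₁ s₂ s₃ ∈ glOrbitHighestWeight₃ N₁ N₂ N₃ n lam := by
  rcases h₁ with ⟨⟨g₁, φ₁⟩, h₁⟩
  rcases h₂ with ⟨⟨g₂, φ₂⟩, h₂⟩
  rcases h₃ with ⟨⟨g₃, φ₃⟩, h₃⟩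
  dsimp only at h₁ h₂ h₃
  rw [← h₁, ← h₂, ← h₃, ← actTensor_powMat_triad]
  exact ⟨g₁, g₂, g₃, φ₁, φ₂, φ₃, φ₁.2, φ₂.2, φ₃.2, rfl⟩

/-- Trilinear span bookkeeping: outer products of vectors in the three one-factor spans lie in the
span of the three-factor orbit set. [folklore] -/
theorem triad_mem_span_glOrbitHighestWeight₃ {lam : Fin 3 → Nat.Partition n} {v₁ : Word N₁ n → ℂ}
    {v₂ : Word N₂ n → ℂ} {v₃ : Word N₃ n → ℂ}
    (h₁ : v₁ ∈ Submodule.span ℂ (glOrbitHighestWeight N₁ n (lam 0)))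
    (h₂ : v₂ ∈ Submodule.span ℂ (glOrbitHighestWeight N₂ n (lam 1)))
    (h₃ : v₃ ∈ Submodule.span ℂ (glOrbitHighestWeight N₃ n (lam 2))) :
    triad v₁ v₂ v₃ ∈ Submodule.span ℂ (glOrbitHighestWeight₃ N₁ N₂ N₃ n lam) := by
  set T := Submodule.span ℂ (glOrbitHighestWeight₃ N₁ N₂ N₃ n lam) with hT
  -- slot 1, with generators in slots 2 and 3
  have step1 : ∀ {s₂ : Word N₂ n → ℂ} {s₃ : Word N₃ n → ℂ},
      s₂ ∈ glOrbitHighestWeight N₂ n (lam 1) → s₃ ∈ glOrbitHighestWeight N₃ n (lam 2) →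
      ∀ {w₁ : Word N₁ n → ℂ}, w₁ ∈ Submodule.span ℂ (glOrbitHighestWeight N₁ n (lam 0)) →
      triad w₁ s₂ s₃ ∈ T := by
    intro s₂ s₃ hs₂ hs₃ w₁ hw₁
    have h := Submodule.apply_mem_span_image_of_mem_span (f := triadₗ₁ s₂ s₃) hw₁
    refine Submodule.span_le.2 ?_ h
    rintro _ ⟨s₁, hs₁, rfl⟩
    exact Submodule.subset_span (triad_mem_glOrbitHighestWeight₃ hs₁ hs₂ hs₃)
  -- slot 2, with a span element in slot 1 and a generator in slot 3
  have step2 : ∀ {s₃ : Word N₃ n → ℂ}, s₃ ∈ glOrbitHighestWeight N₃ n (lam 2) →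
      ∀ {w₂ : Word N₂ n → ℂ}, w₂ ∈ Submodule.span ℂ (glOrbitHighestWeight N₂ n (lam 1)) →
      triad v₁ w₂ s₃ ∈ T := by
    intro s₃ hs₃ w₂ hw₂
    have h := Submodule.apply_mem_span_image_of_mem_span (f := triadₗ₂ v₁ s₃) hw₂
    refine Submodule.span_le.2 ?_ h
    rintro _ ⟨s₂, hs₂, rfl⟩
    exact step1 hs₂ hs₃ h₁
  -- slot 3
  have h := Submodule.apply_mem_span_image_of_mem_span (f := triadₗ₃ v₁ v₂) h₃
  refine Submodule.span_le.2 ?_ h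
  rintro _ ⟨s₃, hs₃, rfl⟩
  exact step2 hs₃ h₂

/-- The product of the three isotypic character sums as a linear map. [folklore] -/
theorem isotypicSum₁₂₃_eq_linearMap (lam : Fin 3 → Nat.Partition n)
    (u : Word N₁ n → Word N₂ n → Word N₃ n → ℂ) :
    isotypicSum₁ (lam 0) (isotypicSum₂ (lam 1) (isotypicSum₃ (lam 2) u)) =
      ((∑ π : Equiv.Perm (Fin n), spechtCharacter ℂ (lam 0) π • permLegsRep₁ π) ∘ₗ
        (∑ π : Equiv.Perm (Fin n), spechtCharacter ℂ (lam 1) π • permLegsRep₂ π) ∘ₗ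
        (∑ π : Equiv.Perm (Fin n), spechtCharacter ℂ (lam 2) π • permLegsRep₃ π)) u := by
  simp only [LinearMap.comp_apply, LinearMap.sum_apply, LinearMap.smul_apply, permLegsRep₁_apply,
    permLegsRep₂_apply, permLegsRep₃_apply, isotypicSum₁, isotypicSum₂, isotypicSum₃]

/-- **The `(λ^{(1)}, λ^{(2)}, λ^{(3)})`-isotypic component of `(ℂ^{N₁} ⊗ ℂ^{N₂} ⊗ ℂ^{N₃})^{⊗n}` is
generated by joint highest-weight vectors** (Schur–Weyl duality, CVZ §3.1 (sw), with Fulton–Harris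
Thm. 6.3 (2), (4): the image of `P_{λ^{(1)}} ⊗ P_{λ^{(2)}} ⊗ P_{λ^{(3)}}` is a sum of copies of the
irreducible `GL × GL × GL`-module `S_{λ^{(1)}}(V₁) ⊗ S_{λ^{(2)}}(V₂) ⊗ S_{λ^{(3)}}(V₃)`): for every
triple `λ` and every `u` the tensor `∏_j (∑_π χ_{λ^{(j)}}(π) π ·_j) u` is a linear
combination of translates `(g₁^{⊗n} ⊗ g₂^{⊗n} ⊗ g₃^{⊗n})(φ₁ ⊗ φ₂ ⊗ φ₃)` of outer products of
highest-weight vectors `φ_j` of weight `λ^{(j)}`.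
[cite: ChristandlVranaZuiddam2023, §3.1 (sw)] [cite: FultonHarrisGTM129, Thm. 6.3] -/
theorem isotypicSum₁₂₃_mem_span_glOrbitHighestWeight₃ (lam : Fin 3 → Nat.Partition n)
    (u : Word N₁ n → Word N₂ n → Word N₃ n → ℂ) :
    isotypicSum₁ (lam 0) (isotypicSum₂ (lam 1) (isotypicSum₃ (lam 2) u)) ∈
      Submodule.span ℂ (glOrbitHighestWeight₃ N₁ N₂ N₃ n lam) := by
  classical
  rw [isotypicSum₁₂₃_eq_linearMap]
  set P := (∑ π : Equiv.Perm (Fin n), spechtCharacter ℂ (lam 0) π • permLegsRep₁ π) ∘ₗ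
        (∑ π : Equiv.Perm (Fin n), spechtCharacter ℂ (lam 1) π • permLegsRep₂ π) ∘ₗ
        (∑ π : Equiv.Perm (Fin n), spechtCharacter ℂ (lam 2) π •
          (permLegsRep₃ π : (Word N₁ n → Word N₂ n → Word N₃ n → ℂ) →ₗ[ℂ]
            (Word N₁ n → Word N₂ n → Word N₃ n → ℂ))) with hP
  have hPu : P u = ∑ a, ∑ b, ∑ c, u a b c • P (triad (Pi.single a 1) (Pi.single b 1) (Pi.single c 1)) := by
    conv_lhs => rw [eq_sum_smul_triad_single u]
    simp only [map_sum, map_smul]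
  rw [hPu]
  refine Submodule.sum_mem _ fun a _ => Submodule.sum_mem _ fun b _ =>
    Submodule.sum_mem _ fun c _ => Submodule.smul_mem _ _ ?_
  rw [hP, ← isotypicSum₁₂₃_eq_linearMap, isotypicSum₃_triad, isotypicSum₂_triad, isotypicSum₁_triad]
  exact triad_mem_span_glOrbitHighestWeight₃
    (sum_spechtCharacter_smul_wordPerm_mem_span (lam 0) _)
    (sum_spechtCharacter_smul_wordPerm_mem_span (lam 1) _)
    (sum_spechtCharacter_smul_wordPerm_mem_span (lam 2) _)

end Generated

end Literature.Computability.AlgebraicComplexity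

end
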